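import Summits.CriticalPhenomena.PercolationContinuityZ3.Theorems.Transplant.FKConjectureCTransport
import Literature.Combinatorics.SimpleGraph.CycleMatroid
import HarnessLib

/-!
# CONJECTURE C″ — THE GRAPHIC SUCCESSOR OF THE REFUTED ALL-MATROID NODE `FK.ConjectureC`: `(ID)_J` FOR THE CYCLE MATROID OF EVERY
# FINITE SIMPLE GRAPH ON ITS EDGE SET, AT EVERY LEVEL (statement only, `@[conjecture]`, NOT asserted; option (E) of record)

Claimed R42 (8)(c) in the cell INBOX at 2026-08-29T08:46:58Z by fkp-10a gen 359 (NEW CLAIM #5 of the gen: the statement-only C″ slot ordered by director-frontier g16, cell INBOX l.8804 / l.8807 / l.8827, option (E) chosen by fk-crit-1 g3 l.8826), addressed to coordinator fk-4 gen 294 (seated 06:59Z 2026-08-29 by l.8791; R172–R175 in force; ruling R176 requested); lineage row FO-10a-g359g (self-suggested), package g359-cgraphic, label CG-A.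
Statement-only file of the `fk-continuity` build cell (bschramm lane; `--supports stmt-CriticalPhenomena-4575 --as helper`), typed by the lane's ledger
writer on director-frontier g16's RULING C″ (prim/bschramm INBOX 2026-08-29T07:39:42Z, item (2); cell INBOX l.8794 / l.8804) after the trigger «(M(K₅),0)
DECIDED TRUE» fired (cert 9db371254390b675: all four Kuratowski matroids `M(K₅)`, `M*(K₅)`, `M(K₃,₃)`, `M*(K₃,₃)` satisfy `(ID)_J` at EVERY level); builds on
p205010 (kernel theorem, internal audit signed; external expert review pending).  ONE `@[conjecture] def` (NOT asserted), two sanity lemmas, two comparison lemmas, no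
named facts, no sorries, no instances, no notation, standard axioms.  NOTHING percolation-bearing follows from the definition.

THE NODE.  `FK.ConjectureC` (file `Transplant/FKConjectureCDefs`: for EVERY finite matroid `M` and every level `J`, the doubly odd nullity-level kernel
`conjCKernel M J = 1{null(x∖y)+null(y∖x) ≤ J} − 1{null(x∩y)+null((x∪y)ᶜ) ≤ J}` lies in the square cone `InPairSquareCone`) is REFUTED in the tree
(`Theorems/FKConjectureC/Negative/SpikeCounterexample`: `FK.not_conjectureC`, witness the rank-3 spike `Z₅∖y₅` on ten elements at `J = 0`, `Σ = −216`,
p703849).  Its successor C″ restricts the matroid to the CYCLE MATROIDS OF FINITE SIMPLE GRAPHS, typed — option (E) of the director's located typing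
question, CHOSEN BY THE CRITIC (fk-crit-1 g3, cell INBOX l.8826; director-frontier g16 record l.8827) — on the EDGE SUBTYPE: the tree's
`Literature.Combinatorics.SimpleGraph.TuttePolynomial.cycleMatroid G : Matroid (Sym2 V)` (ground set `E(G)`, independent sets = forests; Godsil–Royle
§15.2) pulled back to the type `↥G.edgeSet` by Mathlib's `Matroid.restrictSubtype`, so that the pair space is `2^{E(G)} × 2^{E(G)}` exactly (ground set
`univ`, `cycleMatroid_restrictSubtype_ground`; independence = acyclicity of the underlying edge set, `cycleMatroid_restrictSubtype_indep_iff`) — the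
kernel the FK bridge consumes (defs file, TODO(bridge)).  The loops-adjoined variant (L) (`conjCKernel (cycleMatroid G) J` on all of `Sym2 V`, the
non-edges entering `corank` as loops) is deliberately NOT filed: adjoining a loop MIXES LEVELS (`K_J(M ⊕ ℓ)` has diagonal blocks `K_J + 1{al = J}` and
off-diagonal blocks `K_{J−1} − 1{al = J}`, fk-crit-1 08:45Z), so (L) is a consequence of C″ by a block-bookkeeping lemma but is not known to imply it.

STATUS (exact LP certificates unfolded and verified by fk-crit-1 / fk-idea-3,4, 2026-08-29; NOT kernel): DECIDED TRUE for `M(K₅)` (`J = 0..3`), `M*(K₅)`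
(`0..1`), `M(K₃,₃)` (`0..1`), `M*(K₃,₃)` (`0..2`, + the top two levels by THEOREM B), `M(K₄)`, the wheels `W₃, W₄`, every uniform graphic matroid
(cycles `U_{n−1,n}`, bonds) and the graphic part of the `≤ 8`-element census; OPEN in general.  The all-matroid node is refuted (p703849, `S₁₀`) and its
truth set is neither minor-closed (`Z₅ ⊇ S₁₀`) nor closed under 2-sums / parallel extension (`S₈ ∈ (ID)_J ∀ J` exactly, `S₈⁺ = S₈ ⊕₂ U_{1,3} ∉ (ID)_0`,
`Σ = −96`; file `FKConjectureC/Negative/S8ParCounterexample`); the in-class 2-sum closure is crux K3 of record (markdown).  HONESTY: FBP₀ is a FRONTIER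
rung; typing a conjecture proves nothing; BS96 Conj. 4 / `p_c < 1` statements already landed are not re-claimed; typed ≠ proved.

* `FK.ConjectureCGraphic` — the node (NOT asserted);
* `FK.cycleMatroid_restrictSubtype_ground`, `FK.cycleMatroid_restrictSubtype_indep_iff` — the two sanity lemmas of the critic's probe (ground set
  `univ`; independence ⟺ the underlying edge set is a forest);
* `FK.conjectureCGraphic_of_forall_conjectureCOn` — the honest comparison «Conjecture C on EVERY finite ground type ⟹ C″» (the direction
  all-matroids ⟹ graphic; the hypothesis is refuted on `Fin 10`, so this documents the restriction only), and its contrapositive reading through the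
  refuted node, `FK.not_conjectureC_of_not_conjectureCGraphic` (`¬C″ → ¬C`).

## References

* J. Oxley, *Matroid Theory*, 2nd ed., OUP (2011), §1.3 (nullity), §5.1 (graphic matroids), §8.1. [Oxley2011]
* C. Godsil, G. Royle, *Algebraic Graph Theory*, Springer GTM 207 (2001), §15.2 (the cycle matroid). [GodsilRoyle2001]
* D. G. Wagner, *Negatively correlated random variables and Mason's conjecture for independent sets in matroids*, Ann. Comb. 12 (2008) 211–239;
  arXiv:math/0602648 (2006), Thm. 5.8(d), §5.3. [Wagner2006]
* G. Grimmett, *The Random-Cluster Model*, Springer (2006), §3.8–3.9 (negative association for `q < 1`, open problems). [Grimmett2006]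
-/

namespace Summit.CriticalPhenomena.PercolationContinuityZ3.Theorems

namespace FK

open Literature.Combinatorics.SimpleGraph.TuttePolynomial

/-- **Conjecture C″ (`FK.ConjectureCGraphic`, NOT asserted): for every finite simple graph `G` on a finite vertex type `V` and every level `J`, the
doubly odd nullity-level kernel of the CYCLE MATROID `M(G)` ON ITS EDGE SET — `(cycleMatroid G).restrictSubtype G.edgeSet : Matroid ↥G.edgeSet` — lies
in the square cone of the pair space `2^{E(G)} × 2^{E(G)}`: `InPairSquareCone (conjCKernel ((cycleMatroid G).restrictSubtype G.edgeSet) J)`.**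
Successor of the refuted all-matroid node `FK.ConjectureC` (`FK.not_conjectureC`, spike `S₁₀ = Z₅∖y₅`; also `S₈⁺`); DECIDED TRUE by exact LP
certificates for `M(K₅)`, `M(K₃,₃)`, their duals, `M(K₄)`, `W₃`, `W₄`, `F₇`-free graphic census classes at every level tested; OPEN in general; the
loops-adjoined variant (L) is NOT this node (level mixing); nothing percolation-bearing follows from the definition.
[cite: Oxley2011, §5.1 and §1.3] [cite: GodsilRoyle2001, §15.2] [cite: Wagner2006, Thm. 5.8(d), §5.3] -/
@[conjecture] def ConjectureCGraphic : Prop :=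
  ∀ (V : Type) [Fintype V] [DecidableEq V] (G : SimpleGraph V) [DecidableRel G.Adj] (J : ℕ),
    InPairSquareCone (conjCKernel ((cycleMatroid G).restrictSubtype G.edgeSet) J)

/-- Sanity (critic's probe): the ground set of the edge-subtype cycle matroid is EVERYTHING — no off-ground loops enter `corank`.
[cite: GodsilRoyle2001, §15.2] -/
theorem cycleMatroid_restrictSubtype_ground {V : Type} [Fintype V] [DecidableEq V] (G : SimpleGraph V) [DecidableRel G.Adj] :
    ((cycleMatroid G).restrictSubtype G.edgeSet).E = Set.univ :=
  Matroid.restrictSubtype_ground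

/-- Sanity (critic's probe): independence in the edge-subtype cycle matroid is acyclicity of the underlying set of edges («the independent sets of
`M(X)` are precisely the sets of edges that contain no cycles»). [cite: GodsilRoyle2001, §15.2 (p. 325)] -/
theorem cycleMatroid_restrictSubtype_indep_iff {V : Type} [Fintype V] [DecidableEq V] (G : SimpleGraph V) [DecidableRel G.Adj]
    (I : Set ↥G.edgeSet) :
    ((cycleMatroid G).restrictSubtype G.edgeSet).Indep I ↔
      (SimpleGraph.fromEdgeSet (Subtype.val '' I : Set (Sym2 V))).IsAcyclic := by
  rw [Matroid.restrictSubtype_indep_iff, cycleMatroid_indep_iff']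
  constructor
  · rintro ⟨-, h⟩
    exact h
  · intro h
    refine ⟨?_, h⟩
    rintro _ ⟨e, -, rfl⟩
    exact e.2

/-- **The honest comparison: Conjecture C on EVERY finite ground type implies C″** (take the ground type `↥G.edgeSet` and the matroid `M(G)` on it).
The hypothesis is refuted (`FK.not_conjectureCOn_fin_ten`); this records only the direction all-matroids ⟹ graphic. [cite: Oxley2011, §5.1] -/
theorem conjectureCGraphic_of_forall_conjectureCOn (h : ∀ (β : Type) [Fintype β], ConjectureCOn β) : ConjectureCGraphic :=
  fun _ _ _ G _ J => h (↥G.edgeSet) ((cycleMatroid G).restrictSubtype G.edgeSet) J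

/-- **A counterexample to the graphic node would be a counterexample to the all-matroid node** (`¬ C″ → ¬ C`, i.e. `C → C″`:
`ConjectureC` gives Conjecture C on every finite ground type by `conjectureCOn_of_conjectureC`).  Since `ConjectureC` is refuted
(`FK.not_conjectureC`) this documents only that C″ is a RESTRICTION of C; it asserts nothing about C″. [cite: Oxley2011, §5.1] -/
theorem not_conjectureC_of_not_conjectureCGraphic (h : ¬ ConjectureCGraphic) : ¬ ConjectureC := fun hC =>
  h (conjectureCGraphic_of_forall_conjectureCOn fun β _ => conjectureCOn_of_conjectureC (α := β) hC)

end FK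

end Summit.CriticalPhenomena.PercolationContinuityZ3.Theorems
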